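import Summits.ValiantsHypothesis.ValiantsHypothesis.Theorems.BarrierLeverNPCorpusChainBDGIL

/-!
# Route BarrierLever — the NP corpus chain, part 4: the crux in the homogeneous format
# (cell val-lit, NP corpus lead g5)

Parts 1–3 recorded sorry-free arrows between the route's rung decls and the FSV / GKSS / KRST /
CKRST / BDGIL vocabularies. This file records an **equivalent reformulation** of the crux
`Theses.BarrierLever.SuccinctHittingSetsForVP` (stmt-ValiantsHypothesis-14610; FSV Question 6 over
`ℂ`, degree `≤ n` in `n` variables, `N = binom(2n, n)` coefficient variables) in the HOMOGENEOUS
format of [BergEtAl2024] §2.5: degree-`n` FORMS in `n + 1` variables, the slices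
`X_{n,r} = {f : f homogeneous of degree n, cc(f) ≤ r}` of the invariant measure `cc`
(`BergEtAl2024.slice (fun _ _ f => affComplexity f) (n+1) n r`), and metapolynomials
`Δ ∈ ℂ[c_m : |m| = n]` evaluated at `formCoeff n f`:

* `crux_iff_slices : crux ↔ ∀ a, ∃ b n₀, ∀ n ≥ n₀, every nonzero metapolynomial Δ of format
  (·, n, n+1) with L(Δ) ≤ N^a and deg Δ ≤ N^a is nonzero at formCoeff n f for some f ∈ X_{n, n^b}`
  (`N = binom(2n, n)` is also the number of degree-`n` monomials in `n + 1` variables,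
  `numMonomials_succ` of part 3a).

Why this is worth recording: the homogeneous format is the one on which `GL_{n+1}(ℂ)` acts
(`coordRep`), the slices are `GL`-stable (`isInvariantMeasure_affComplexity`), and the
representation-theoretic statements of [BergEtAl2024] (Thm. 1.1, Cor. 1.2, Thm. 2.4) and of GCT live
there; the equivalence lets a prover of the crux work entirely in that setting without changing
the item. The two directions are the two changes of format: homogenisation
`g ↦ Σ_i x₀^{n-i} g_i` (`homog`; cost `≤ n^{b+7}` from the tree's
`complexity_homogeneousComponent_le_sq_mul`, [BCS97 (21.25)]) and dehomogenisation `x₀ ↦ 1` (part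
3a's `dehom_mem_smallCircuits`, exponent `b + 6`), transported along the bijection
`homIdx : degLEMonomials n ≃ DegIdx (Fin (n+1)) n` of part 3b (`homIdx_bijective`).

Honest framing: an EQUIVALENT REFORMULATION of an OPEN statement (FSV Question 6 over `ℂ`); both
sides are open in print and in the tree; `VP ≠ VNP` is not touched. No `sorry`; no named facts;
the only `def` is the homogenisation map `homog`.

References: [BergEtAl2024] §2.1 (cc, `X_{d,r}`), §2.5 (arXiv:2411.03444, PDF p.7, p.10–11);
[ForbesShpilkaVolk2018] Question 6, Cor. 5; [BurgisserClausenShokrollahi1997] Lemma (21.25).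
-/

set_option linter.dupNamespace false

noncomputable section

namespace Summit.ValiantsHypothesis.ValiantsHypothesis.Theorems.BarrierLever.NPCorpusChainSlices

open MvPolynomial Literature.Barriers.ValiantsHypothesis Literature.Computability.AlgebraicComplexity
open Literature.Barriers.ValiantsHypothesis.BergEtAl2024
open Summit.ValiantsHypothesis.ValiantsHypothesis.Theorems.BarrierLever.NPCorpusChainBDGILPrelims
open Summit.ValiantsHypothesis.ValiantsHypothesis.Theorems.BarrierLever.NPCorpusChainBDGIL

/-! ### The re-indexing is a bijection -/

/-- `homIdx n` is onto: a degree-`n` monomial `d` in `x₀, …, x_n` is `x₀^{d 0} · x^{tail d}` with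
`|tail d| ≤ n`. [folklore] -/
theorem homIdx_surjective (n : ℕ) : Function.Surjective (homIdx n) := by
  intro d
  have hd : (d : Fin (n + 1) →₀ ℕ).degree = n := mem_degMonomials_iff.1 d.2
  have hdeg : (d : Fin (n + 1) →₀ ℕ) 0 + (Finsupp.tail (d : Fin (n + 1) →₀ ℕ)).degree = n := by
    rw [← Literature.Barriers.Schanuel.degree_cons, Finsupp.cons_tail]; exact hd
  refine ⟨⟨Finsupp.tail (d : Fin (n + 1) →₀ ℕ), ?_⟩, ?_⟩
  · show (Finsupp.tail (d : Fin (n + 1) →₀ ℕ)).degree ≤ n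
    omega
  · apply Subtype.ext
    show Finsupp.cons (n - (Finsupp.tail (d : Fin (n + 1) →₀ ℕ)).degree)
      (Finsupp.tail (d : Fin (n + 1) →₀ ℕ)) = (d : Fin (n + 1) →₀ ℕ)
    rw [show n - (Finsupp.tail (d : Fin (n + 1) →₀ ℕ)).degree = (d : Fin (n + 1) →₀ ℕ) 0 by omega]
    exact Finsupp.cons_tail _

/-- `homIdx n : degLEMonomials n → DegIdx (Fin (n+1)) n` is a bijection. [folklore] -/
theorem homIdx_bijective (n : ℕ) : Function.Bijective (homIdx n) :=
  ⟨homIdx_injective n, homIdx_surjective n⟩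

/-! ### Homogenisation to degree `n` in `n + 1` variables -/

/-- The homogenisation `g ↦ Σ_{i ≤ n} x₀^{n-i} · g_i(x₁, …, x_n)` of a polynomial of degree `≤ n`
(`g_i` its homogeneous components). [folklore] -/
def homog (n : ℕ) (g : MvPolynomial (Fin n) ℂ) : MvPolynomial (Fin (n + 1)) ℂ :=
  ∑ i ∈ Finset.range (n + 1), X 0 ^ (n - i) * rename Fin.succ (homogeneousComponent i g)

/-- The homogenisation is a form of degree `n`. [folklore] -/
theorem homog_isHomogeneous (n : ℕ) (g : MvPolynomial (Fin n) ℂ) : (homog n g).IsHomogeneous n := by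
  refine IsHomogeneous.sum _ _ _ fun i hi => ?_
  rw [Finset.mem_range] at hi
  have h : ((X 0 : MvPolynomial (Fin (n + 1)) ℂ) ^ (n - i) *
      rename Fin.succ (homogeneousComponent i g)).IsHomogeneous (1 * (n - i) + i) :=
    ((isHomogeneous_X ℂ 0).pow (n - i)).mul
      (homogeneousComponent_isHomogeneous i g).rename_isHomogeneous
  have e : 1 * (n - i) + i = n := by omega
  rw [e] at h
  exact h

/-- Dehomogenising the homogenisation gives back `g` (for `deg g ≤ n`). [folklore] -/
theorem dehom_homog (n : ℕ) {g : MvPolynomial (Fin n) ℂ} (hg : g.totalDegree ≤ n) :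
    aeval (dehomArgs n) (homog n g) = g := by
  have hcomp : (fun j => dehomArgs n (Fin.succ j)) = X := funext fun j => dehomArgs_succ n j
  simp only [homog, map_sum, map_mul, map_pow, aeval_X, dehomArgs_zero, one_pow, one_mul,
    aeval_rename, Function.comp_def, hcomp, aeval_X_left, AlgHom.coe_id, id_eq]
  rw [← Finset.sum_subset (Finset.range_subset_range.mpr (Nat.succ_le_succ hg))
    (fun i hi hi' => by
      apply homogeneousComponent_eq_zero
      rw [Finset.mem_range] at hi hi'
      omega)]
  exact sum_homogeneousComponent g

/-- **Coefficients of the homogenisation**: the `x₀^{n-|m|} x^m`-coefficient of `homog n g` is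
the `x^m`-coefficient of `g` (`|m| ≤ n`, `deg g ≤ n`). [folklore] -/
theorem coeff_homog (n : ℕ) {g : MvPolynomial (Fin n) ℂ} (hg : g.totalDegree ≤ n)
    (m : Fin n →₀ ℕ) (hm : m.degree ≤ n) :
    coeff (Finsupp.cons (n - m.degree) m) (homog n g) = coeff m g := by
  rw [← coeff_dehom_of_isHomogeneous (dehomArgs_zero n) (dehomArgs_succ n)
    (homog_isHomogeneous n g) m hm, dehom_homog n hg]

/-- The coefficient vector of `g` and the form-coefficient vector of `homog n g` agree along
`homIdx`. [folklore] -/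
theorem formCoeff_homog_comp_homIdx (n : ℕ) {g : MvPolynomial (Fin n) ℂ} (hg : g.totalDegree ≤ n) :
    formCoeff n (homog n g) ∘ homIdx n = coeffVector (degLEMonomials n) g := by
  funext m
  simp only [Function.comp_apply, formCoeff_apply, coeffVector_apply, homIdx]
  exact coeff_homog n hg _ m.2

/-- The form-coefficient vector of a degree-`n` form `f` and the coefficient vector of its
dehomogenisation agree along `homIdx` (part 3a's `coeff_dehom_of_isHomogeneous`). [folklore] -/
theorem formCoeff_comp_homIdx_of_isHomogeneous (n : ℕ) {f : MvPolynomial (Fin (n + 1)) ℂ}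
    (hf : f.IsHomogeneous n) :
    formCoeff n f ∘ homIdx n = coeffVector (degLEMonomials n) (aeval (dehomArgs n) f) := by
  funext m
  simp only [Function.comp_apply, formCoeff_apply, coeffVector_apply, homIdx]
  exact (coeff_dehom_of_isHomogeneous (dehomArgs_zero n) (dehomArgs_succ n) hf _ m.2).symm

/-! ### The cost of homogenisation -/

/-- `L(x₀^j) ≤ j`. [folklore] -/
theorem complexity_X_pow_le (n j : ℕ) :
    complexity ((X 0 : MvPolynomial (Fin (n + 1)) ℂ) ^ j) ≤ j := by
  rw [Finset.pow_eq_prod_const]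
  refine (complexity_finset_prod_le _ _).trans ?_
  rw [Finset.sum_eq_zero fun _ _ => complexity_X_holds (k := ℂ) (σ := Fin (n + 1)) 0,
    Finset.card_range, zero_add]

/-- **Homogenising is cheap**: `L(homog n g) ≤ (n + 1) · (n + (n + 2)² · L(g) + 1) + (n + 1)`
(one homogeneous component costs `(i + 2)² L(g)` by [BCS97 (21.25)], the power of `x₀` at most
`n`, one product gate each, then `n + 1` summands).
[cite: BurgisserClausenShokrollahi1997, Lemma (21.25)] -/
theorem complexity_homog_le (n : ℕ) (g : MvPolynomial (Fin n) ℂ) :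
    complexity (homog n g) ≤ (n + 1) * (n + (n + 2) ^ 2 * complexity g + 1) + (n + 1) := by
  unfold homog
  refine (complexity_finset_sum_le _ _).trans ?_
  rw [Finset.card_range]
  refine Nat.add_le_add_right ?_ _
  calc ∑ i ∈ Finset.range (n + 1), complexity ((X 0 : MvPolynomial (Fin (n + 1)) ℂ) ^ (n - i) *
          rename Fin.succ (homogeneousComponent i g))
      ≤ ∑ _i ∈ Finset.range (n + 1), (n + (n + 2) ^ 2 * complexity g + 1) := by
        refine Finset.sum_le_sum fun i hi => ?_
        rw [Finset.mem_range] at hi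
        refine (complexity_mul_le_holds _ _).trans ?_
        have h1 : complexity ((X 0 : MvPolynomial (Fin (n + 1)) ℂ) ^ (n - i)) ≤ n :=
          (complexity_X_pow_le n _).trans (Nat.sub_le n i)
        have h2 : complexity (rename Fin.succ (homogeneousComponent i g)) ≤
            (n + 2) ^ 2 * complexity g :=
          (complexity_rename_le_holds' _ _).trans
            ((complexity_homogeneousComponent_le_sq_mul g i).trans
              (Nat.mul_le_mul_right _ (Nat.pow_le_pow_left (by omega) 2)))
        omega
    _ = (n + 1) * (n + (n + 2) ^ 2 * complexity g + 1) := by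
        rw [Finset.sum_const, Finset.card_range, smul_eq_mul]

/-- Exponent bookkeeping: for `n ≥ 2` and `L ≤ n^b` the homogenisation cost is `≤ n^{b+7}`.
[folklore] -/
theorem homog_cost_le_pow (n b L : ℕ) (hn : 2 ≤ n) (hL : L ≤ n ^ b) :
    (n + 1) * (n + (n + 2) ^ 2 * L + 1) + (n + 1) ≤ n ^ (b + 7) := by
  have hP : 1 ≤ n ^ b := Nat.one_le_pow _ _ (by omega)
  have h1 : (n + 1) * (n + (n + 2) ^ 2 * L + 1) + (n + 1) =
      (n + 1) * (n + 2) * (1 + (n + 2) * L) := by ring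
  rw [h1]
  have h2 : 1 + (n + 2) * L ≤ (n + 3) * n ^ b := by nlinarith
  calc (n + 1) * (n + 2) * (1 + (n + 2) * L)
      ≤ (n + 1) * (n + 2) * ((n + 3) * n ^ b) := Nat.mul_le_mul_left _ h2
    _ ≤ (2 * n) * (2 * n) * ((3 * n) * n ^ b) := by gcongr <;> omega
    _ = 12 * n ^ 3 * n ^ b := by ring
    _ ≤ n ^ 4 * n ^ 3 * n ^ b := by
        have : 12 ≤ n ^ 4 := by nlinarith [Nat.pow_le_pow_left hn 4]
        exact Nat.mul_le_mul_right _ (Nat.mul_le_mul_right _ this)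
    _ = n ^ (b + 7) := by ring

/-- **The homogenisation of a member of FSV's simple class lies in the slice `X_{n, n^{b+7}}`.**
[cite: BergEtAl2024, §2.5 (X_{d,r}), p.9 (PDF p.10)] -/
theorem homog_mem_slice {n b : ℕ} (hn : 2 ≤ n) {g : MvPolynomial (Fin n) ℂ}
    (hg : g ∈ SmallCircuits ℂ n b) :
    homog n g ∈ slice (fun _ _ f => affComplexity f) (n + 1) n (n ^ (b + 7)) :=
  ⟨homog_isHomogeneous n g, (affComplexity_le_complexity _).trans
    ((complexity_homog_le n g).trans (homog_cost_le_pow n b _ hn hg.2))⟩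

/-! ### The two changes of format -/

/-- **Crux ⟹ slices hit.** If degree-`≤ n` polynomials of circuit size `n^b` hit the FSV
distinguishers of exponent `a`, then the slices `X_{n, n^{b+7}}` of degree-`n` forms in `n + 1`
variables with `cc ≤ n^{b+7}` hit every nonzero metapolynomial of size and degree `≤ N^a`,
`N = binom(2n, n)` (pull the metapolynomial back along `homIdx`, hit it, homogenise the witness).
[cite: BergEtAl2024, §2.5; ForbesShpilkaVolk2018, Question 6] -/
theorem slices_hit_of_hitting {n a b : ℕ} (hn : 2 ≤ n)
    (h : IsSuccinctHittingSet (degLEMonomials n) (SmallCircuits ℂ n b) (Distinguishers ℂ n a))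
    (Δ : MvPolynomial (DegIdx (Fin (n + 1)) n) ℂ) (hΔc : complexity Δ ≤ ((2 * n).choose n) ^ a)
    (hΔd : Δ.totalDegree ≤ ((2 * n).choose n) ^ a) (hΔ0 : Δ ≠ 0) :
    ∃ f ∈ slice (fun _ _ f => affComplexity f) (n + 1) n (n ^ (b + 7)),
      eval (formCoeff n f) Δ ≠ 0 := by
  classical
  let e : degLEMonomials n ≃ DegIdx (Fin (n + 1)) n := Equiv.ofBijective _ (homIdx_bijective n)
  set D : MvPolynomial (degLEMonomials n) ℂ := rename e.symm Δ with hD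
  have hDmem : D ∈ Distinguishers ℂ n a :=
    ⟨(complexity_rename_le_holds' _ _).trans hΔc, (totalDegree_rename_le _ _).trans hΔd⟩
  have hD0 : D ≠ 0 := fun h0 => hΔ0 (rename_injective _ e.symm.injective (by rw [map_zero]; exact h0))
  obtain ⟨g, hg, hne⟩ := h D hDmem hD0
  refine ⟨homog n g, homog_mem_slice hn hg, ?_⟩
  have key : coeffVector (degLEMonomials n) g ∘ e.symm = formCoeff n (homog n g) := by
    funext d
    rw [← formCoeff_homog_comp_homIdx n hg.1]
    show formCoeff n (homog n g) (homIdx n (e.symm d)) = formCoeff n (homog n g) d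
    congr 1
    exact e.apply_symm_apply d
  rwa [hD, eval_rename, key] at hne

/-- **Slices hit ⟹ crux-type hitting.** If the slices `X_{n, n^b}` hit every nonzero
metapolynomial of size and degree `≤ N^a`, then degree-`≤ n` polynomials of circuit size
`n^{b+6}` hit the FSV distinguishers of exponent `a` (push the distinguisher forward along
`homIdx`, hit it with a form, dehomogenise the form by `x₀ ↦ 1`, part 3a).
[cite: BergEtAl2024, §2.5; ForbesShpilkaVolk2018, Question 6] -/
theorem hitting_of_slices_hit {n a b : ℕ} (hn : 2 ≤ n)
    (h : ∀ Δ : MvPolynomial (DegIdx (Fin (n + 1)) n) ℂ, complexity Δ ≤ ((2 * n).choose n) ^ a →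
      Δ.totalDegree ≤ ((2 * n).choose n) ^ a → Δ ≠ 0 →
      ∃ f ∈ slice (fun _ _ f => affComplexity f) (n + 1) n (n ^ b), eval (formCoeff n f) Δ ≠ 0) :
    IsSuccinctHittingSet (degLEMonomials n) (SmallCircuits ℂ n (b + 6)) (Distinguishers ℂ n a) := by
  intro D hD hD0
  have hΔc : complexity (rename (homIdx n) D) ≤ ((2 * n).choose n) ^ a :=
    (complexity_rename_le_holds' _ _).trans hD.1
  have hΔd : (rename (homIdx n) D).totalDegree ≤ ((2 * n).choose n) ^ a :=
    (totalDegree_rename_le _ _).trans hD.2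
  have hΔ0 : rename (homIdx n) D ≠ 0 := fun h0 =>
    hD0 (rename_injective _ (homIdx_injective n) (by rw [map_zero]; exact h0))
  obtain ⟨f, ⟨hfh, hfc⟩, hne⟩ := h _ hΔc hΔd hΔ0
  refine ⟨aeval (dehomArgs n) f, ?_, ?_⟩
  · exact dehom_mem_smallCircuits (dehomArgs_zero n) (dehomArgs_succ n) hfh hfc
      (overhead_le_pow b n (n ^ b) hn (Nat.le_add_right _ _))
  · rwa [eval_rename, formCoeff_comp_homIdx_of_isHomogeneous n hfh] at hne

/-! ### The equivalence -/

/-- **The crux in the homogeneous format of [BergEtAl2024].** FSV Question 6 over `ℂ` (the route's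
crux, degree `≤ n` in `n` variables) holds iff for every distinguisher exponent `a` there are `b`,
`n₀` such that for all `n ≥ n₀` the slice `X_{n, n^b}` of degree-`n` forms in `n + 1` variables
with `cc ≤ n^b` hits every nonzero metapolynomial `Δ` of format `(·, n, n+1)` with
`L(Δ) ≤ N^a`, `deg Δ ≤ N^a`, `N = binom(2n, n)`. Both sides are OPEN; this is a reformulation,
not progress. [cite: BergEtAl2024, §2.5; ForbesShpilkaVolk2018, Question 6] -/
theorem crux_iff_slices :
    Theses.BarrierLever.SuccinctHittingSetsForVP ↔
      ∀ a : ℕ, ∃ b n₀ : ℕ, ∀ n : ℕ, n₀ ≤ n →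
        ∀ Δ : MvPolynomial (DegIdx (Fin (n + 1)) n) ℂ, complexity Δ ≤ ((2 * n).choose n) ^ a →
          Δ.totalDegree ≤ ((2 * n).choose n) ^ a → Δ ≠ 0 →
          ∃ f ∈ slice (fun _ _ f => affComplexity f) (n + 1) n (n ^ b),
            eval (formCoeff n f) Δ ≠ 0 := by
  constructor
  · intro hcrux a
    obtain ⟨b, n₀, hb⟩ := hcrux a
    refine ⟨b + 7, max n₀ 2, fun n hn Δ hΔc hΔd hΔ0 => ?_⟩
    exact slices_hit_of_hitting (le_of_max_le_right hn) (hb n (le_of_max_le_left hn)) Δ hΔc hΔd hΔ0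
  · intro hs a
    obtain ⟨b, n₀, hb⟩ := hs a
    refine ⟨b + 6, max n₀ 2, fun n hn => ?_⟩
    exact hitting_of_slices_hit (le_of_max_le_right hn) (hb n (le_of_max_le_left hn))

/-- The homogeneous-format hypothesis SUFFICES for the crux (the direction a prover working in the
`GL_{n+1}`-equivariant setting needs). [cite: BergEtAl2024, §2.5; ForbesShpilkaVolk2018, Question 6] -/
theorem crux_of_slices_hit
    (hs : ∀ a : ℕ, ∃ b n₀ : ℕ, ∀ n : ℕ, n₀ ≤ n →
      ∀ Δ : MvPolynomial (DegIdx (Fin (n + 1)) n) ℂ, complexity Δ ≤ ((2 * n).choose n) ^ a →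
        Δ.totalDegree ≤ ((2 * n).choose n) ^ a → Δ ≠ 0 →
        ∃ f ∈ slice (fun _ _ f => affComplexity f) (n + 1) n (n ^ b),
          eval (formCoeff n f) Δ ≠ 0) :
    Theses.BarrierLever.SuccinctHittingSetsForVP :=
  crux_iff_slices.2 hs

end Summit.ValiantsHypothesis.ValiantsHypothesis.Theorems.BarrierLever.NPCorpusChainSlices

end
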